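import Summits.Parity.GeneralizedHardyLittlewood.Theorems.PrimeLevelFamEdgeMomentsBeyondDiagonalDiagLTerm
import Summits.Parity.GeneralizedHardyLittlewood.Theorems.PrimeLevelFamEdgeMomentsBeyondDiagonalDiagPrimeCoupling
import HarnessLib

/-!
# Route `PrimeLevelFamEdge`, crux K_A `MomentsBeyondDiagonal` (stmt-Parity-20007), line «petersson_layers» v4, stub `stub_diag`:
# **the prime term of the general-profile kernel form: `2Σ_{n≤M} φ(n)W(n)²𝒮_n𝒫_n = ζ(2)²·P′(1)²/log²M + O(log⁻³M)`**

Census item G5/G6 (the `𝒫`-term with its error budget) of the `stub_diag` repair census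
(`Lines/petersson_layers_stub_diag_g4_bricks.md`). In Selberg coordinates the kernel form of the profile `P` is
`Σ_n φ(n)W(n)²((L+κ(n))𝒮_n² + 2𝒮_n𝒫_n)` (`quadForm_profile_eq`); the `L`-term is `…DiagLTerm`. Here, with the profile
coordinate `𝒮_n = m_n + δ_n`, `m_n = E_n P″(u_n)/log²M` (`…DiagProfileCoord`) and the prime coupling
`𝒫_n = p_n + ε_n`, `p_n = E_n P′(u_n)/log M`, `|ε_n| ≪ D(n)(1+κ(n))/log²M` (`…DiagPrimeCoupling`):

* `two_mul_integral_derivative_mul_eval` — `2∫₀¹R′R = R(1)² − R(0)²` (so `2∫₀¹P″P′ = P′(1)²` when `P′(0) = 0`);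
* `abs_PMain_sub_le` — `|2Σ_n φW²m_np_n − ζ(2)²P′(1)²/log²M| ≤ C/log³M` (`φW²E² = ζ(2)|W|E`, polynomial weight `P″P′`);
* `abs_PErr_le` — `Σ_n|φW²·2(𝒮_n𝒫_n − m_np_n)| ≤ C/log³M` (dyadic sum, `ΣD²/n`, `ΣκD²/n` of `KernelFormXSqSums/B`);
* `abs_PTerm_sub_le` — **`|Σ_{n≤M}φ(n)W(n)²·2𝒮_n𝒫_n − ζ(2)²·P′(1)²/log²M| ≤ C_P/log³M`** for `M ≥ 3`, `P₀ = P₁ = 0`.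
  At `P = X²` this is the constant `4ζ(2)²/log²M` of `kernelForm_xsq_asymp`.

Def-free; theorems only. Helper `--supports stmt-Parity-20007`; closes nothing; K_A, K_B and the Parity summit are
NOT proved; nothing about Landau–Siegel zeros.

## References
* E. Kowalski, P. Michel, J. VanderKam, J. reine angew. Math. 526 (2000), Prop. 5.1 (31) p. 18 (the term
  `(Q(1)P′(1))²` of the second moment at `Q = 1`). [cite: KowalskiMichelVanderKam2000, Prop. 5.1 — derivation]
-/

noncomputable section

open scoped Real ArithmeticFunction.Moebius ArithmeticFunction.sigma ArithmeticFunction.zeta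
open Finset ArithmeticFunction Polynomial MeasureTheory intervalIntegral

namespace Summit.Parity.GeneralizedHardyLittlewood.Theorems.MomentsBeyondDiagonal.DiagKernel

open Literature.NumberTheory.LFunctions Literature.NumberTheory.LFunctions.KMV2000
open MollifierMainTerm (W)
open SelbergCoord (kappa)
open Literature.NumberTheory.Sieve (one_le_log_of_three_le)
open Summit.Parity.GeneralizedHardyLittlewood.Theorems.BeyondDiagonalBeatsQuarter.KernelFormXSq
  (copTauW mainConst divWeight divWeight_nonneg mainConst_nonneg mainConst_le_divWeight
    totient_mul_W_sq_mul_mainConst totient_mul_W_sq_le sum_divWeight_sq_div_le sum_divWeight_sq_dyadic_le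
    sum_kappa_divWeight_sq_div_le)

/-! ### Small facts -/

/-- **`2∫₀¹R′(u)R(u)du = R(1)² − R(0)²`** for a real polynomial `R` (fundamental theorem of calculus for `R²`).
[folklore] -/
theorem two_mul_integral_derivative_mul_eval (R : ℝ[X]) :
    2 * ∫ u in (0 : ℝ)..1, (derivative R).eval u * R.eval u = R.eval 1 ^ 2 - R.eval 0 ^ 2 := by
  have hderiv : ∀ u ∈ Set.uIcc (0 : ℝ) 1,
      HasDerivAt (fun u ↦ R.eval u * R.eval u)
        ((derivative R).eval u * R.eval u + R.eval u * (derivative R).eval u) u :=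
    fun u _ ↦ (R.hasDerivAt u).mul (R.hasDerivAt u)
  have hcont : Continuous fun u : ℝ ↦ (derivative R).eval u * R.eval u + R.eval u * (derivative R).eval u :=
    ((derivative R).continuous.mul R.continuous).add (R.continuous.mul (derivative R).continuous)
  have h := intervalIntegral.integral_eq_sub_of_hasDerivAt hderiv (hcont.intervalIntegrable 0 1)
  have h2 : (∫ u in (0 : ℝ)..1, (derivative R).eval u * R.eval u + R.eval u * (derivative R).eval u) =
      2 * ∫ u in (0 : ℝ)..1, (derivative R).eval u * R.eval u := by
    rw [← intervalIntegral.integral_const_mul]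
    exact intervalIntegral.integral_congr fun u _ ↦ by ring
  rw [← h2, h]
  ring

/-- `P′(0) = 0` for `P` with `P₁ = 0`. [folklore] -/
theorem derivative_eval_zero_of_coeff_one (P : ℝ[X]) (hP1 : P.coeff 1 = 0) : (derivative P).eval 0 = 0 := by
  rw [← Polynomial.coeff_zero_eq_eval_zero, Polynomial.coeff_derivative, hP1]
  simp

/-! ### The main part `2Σ φW²m_np_n` -/

/-- **The prime main part**: with `m_n = E_n·P″(u_n)/log²M`, `p_n = E_n·P′(u_n)/log M`, `u_n = log(M/n)/log M`,
`|Σ_{n≤M}φ(n)W(n)²·2m_np_n − ζ(2)²·P′(1)²/log²M| ≤ C/log³M` for `M ≥ 3` when `P₁ = 0`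
(`φW²E² = ζ(2)|W|E`, polynomial weight `P″P′`, `2∫₀¹P″P′ = P′(1)²`).
[cite: KowalskiMichelVanderKam2000, Prop. 5.1 — derivation] -/
theorem abs_PMain_sub_le (P : ℝ[X]) (hP1 : P.coeff 1 = 0) :
    ∃ C : ℝ, 0 < C ∧ ∀ M : ℝ, 3 ≤ M →
      |∑ n ∈ Icc 1 ⌊M⌋₊, (Nat.totient n : ℝ) * W n ^ 2 *
          (2 * (mainConst n * ((derivative (derivative P)).eval (Real.log (M / n) / Real.log M) / Real.log M ^ 2)) *
            (mainConst n * (derivative P).eval (Real.log (M / n) / Real.log M) / Real.log M)) -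
        (π ^ 2 / 6) ^ 2 * (derivative P).eval 1 ^ 2 / Real.log M ^ 2| ≤ C / Real.log M ^ 3 := by
  set Q := derivative (derivative P) with hQ
  set Q₁ := derivative P with hQ₁
  obtain ⟨C₄, hC₄, h4⟩ := abs_sum_absW_mainConst_mul_eval_sub_integral_le (Q * Q₁)
  refine ⟨2 * (π ^ 2 / 6) * C₄ + 1, by positivity, fun M hM ↦ ?_⟩
  set ℓ := Real.log M with hℓ
  have hℓ1 : 1 ≤ ℓ := one_le_log_of_three_le hM
  have hℓ0 : 0 < ℓ := by linarith
  -- `φW²·2mp = (2ζ(2)/ℓ³)·|W|E·(QQ₁)(u)`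
  have hmain : ∑ n ∈ Icc 1 ⌊M⌋₊, (Nat.totient n : ℝ) * W n ^ 2 *
      (2 * (mainConst n * (Q.eval (Real.log (M / n) / ℓ) / ℓ ^ 2)) *
        (mainConst n * Q₁.eval (Real.log (M / n) / ℓ) / ℓ)) =
      2 * (π ^ 2 / 6) / ℓ ^ 3 * ∑ n ∈ Icc 1 ⌊M⌋₊, |W n| * mainConst n * (Q * Q₁).eval (Real.log (M / n) / ℓ) := by
    rw [Finset.mul_sum]
    refine Finset.sum_congr rfl fun n hn ↦ ?_
    have hn0 : n ≠ 0 := by have := (Finset.mem_Icc.1 hn).1; omega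
    have h := totient_mul_W_sq_mul_mainConst hn0
    rw [Polynomial.eval_mul]
    calc (Nat.totient n : ℝ) * W n ^ 2 *
          (2 * (mainConst n * (Q.eval (Real.log (M / n) / ℓ) / ℓ ^ 2)) *
            (mainConst n * Q₁.eval (Real.log (M / n) / ℓ) / ℓ))
        = ((Nat.totient n : ℝ) * W n ^ 2 * mainConst n) * mainConst n *
            (2 * (Q.eval (Real.log (M / n) / ℓ) * Q₁.eval (Real.log (M / n) / ℓ))) / ℓ ^ 3 := by ring
      _ = 2 * (π ^ 2 / 6) / ℓ ^ 3 * (|W n| * mainConst n *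
            (Q.eval (Real.log (M / n) / ℓ) * Q₁.eval (Real.log (M / n) / ℓ))) := by rw [h]; ring
  have hI := h4 M hM
  have hFTC : 2 * ∫ u in (0 : ℝ)..1, (Q * Q₁).eval u = Q₁.eval 1 ^ 2 := by
    have he : (∫ u in (0 : ℝ)..1, (Q * Q₁).eval u) = ∫ u in (0 : ℝ)..1, (derivative Q₁).eval u * Q₁.eval u :=
      intervalIntegral.integral_congr fun u _ ↦ by simp [Polynomial.eval_mul, hQ, hQ₁]
    rw [he, two_mul_integral_derivative_mul_eval, hQ₁, derivative_eval_zero_of_coeff_one P hP1]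
    ring
  rw [hmain]
  have key : 2 * (π ^ 2 / 6) / ℓ ^ 3 * ∑ n ∈ Icc 1 ⌊M⌋₊, |W n| * mainConst n * (Q * Q₁).eval (Real.log (M / n) / ℓ) -
      (π ^ 2 / 6) ^ 2 * Q₁.eval 1 ^ 2 / ℓ ^ 2 =
      2 * (π ^ 2 / 6) / ℓ ^ 3 * (∑ n ∈ Icc 1 ⌊M⌋₊, |W n| * mainConst n * (Q * Q₁).eval (Real.log (M / n) / ℓ) -
        π ^ 2 / 6 * ℓ * ∫ u in (0 : ℝ)..1, (Q * Q₁).eval u) := by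
    rw [← hFTC]
    field_simp
  rw [key, abs_mul, abs_of_nonneg (by positivity : (0 : ℝ) ≤ 2 * (π ^ 2 / 6) / ℓ ^ 3)]
  calc 2 * (π ^ 2 / 6) / ℓ ^ 3 * |∑ n ∈ Icc 1 ⌊M⌋₊, |W n| * mainConst n * (Q * Q₁).eval (Real.log (M / n) / ℓ) -
          π ^ 2 / 6 * ℓ * ∫ u in (0 : ℝ)..1, (Q * Q₁).eval u|
      ≤ 2 * (π ^ 2 / 6) / ℓ ^ 3 * C₄ := by gcongr
    _ = 2 * (π ^ 2 / 6) * C₄ / ℓ ^ 3 := by ring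
    _ ≤ (2 * (π ^ 2 / 6) * C₄ + 1) / ℓ ^ 3 := by gcongr; linarith


/-! ### The error part `Σ φW²·2(𝒮𝒫 − mp)` -/

/-- Scalar bookkeeping: `(a/(bℓ²) + 1/ℓ³) ≤ 2/ℓ²` for `b ≥ 1`, `ℓ ≥ 1`. [folklore] -/
theorem inv_scale_sum_le {b ℓ : ℝ} (hb : 1 ≤ b) (hℓ : 1 ≤ ℓ) :
    1 / (b * ℓ ^ 2) + 1 / ℓ ^ 3 ≤ 2 / ℓ ^ 2 := by
  have hℓ0 : 0 < ℓ := by linarith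
  have he1 : 1 / (b * ℓ ^ 2) ≤ 1 / ℓ ^ 2 := by
    apply one_div_le_one_div_of_le (by positivity)
    nlinarith [pow_pos hℓ0 2]
  have he2 : 1 / ℓ ^ 3 ≤ 1 / ℓ ^ 2 :=
    one_div_le_one_div_of_le (by positivity) (pow_le_pow_right₀ hℓ (by norm_num))
  have h2 : (2 : ℝ) / ℓ ^ 2 = 1 / ℓ ^ 2 + 1 / ℓ ^ 2 := by ring
  rw [h2]
  exact add_le_add he1 he2

set_option maxHeartbeats 400000 in
/-- **The prime error part**: for `P` with `P₀ = P₁ = 0` and `M ≥ 3`, with `𝒮_n` the profile coordinate, `𝒫_n` the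
prime coupling, `m_n = E_nP″(u_n)/log²M`, `p_n = E_nP′(u_n)/log M`:
`Σ_{n≤M}|φ(n)W(n)²·(2𝒮_n𝒫_n − 2m_np_n)| ≤ C/log³M`
(`𝒮𝒫 − mp = (𝒮−m)𝒫 + m(𝒫−p)`, sizes from `…DiagProfileCoord` / `…DiagPrimeCoupling`, sums `ΣD²/(n(1+log(M/n))²) ≤ 8Z`,
`ΣD²/n ≤ Z(2+log N)`, `ΣκD²/n ≤ 48Z(2+log N)`). [cite: KowalskiMichelVanderKam2000, Prop. 5.1 — derivation (error bookkeeping)] -/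
theorem abs_PErr_le (P : ℝ[X]) (hP0 : P.coeff 0 = 0) (hP1 : P.coeff 1 = 0) :
    ∃ C : ℝ, 0 < C ∧ ∀ M : ℝ, 3 ≤ M →
      ∑ n ∈ Icc 1 ⌊M⌋₊, |(Nat.totient n : ℝ) * W n ^ 2 *
          (2 * ((∑ c ∈ Finset.range (P.natDegree + 1), P.coeff c *
                ((∑ k ∈ Icc 1 ⌊M / n⌋₊, copTauW n k * Real.log (M / n / k) ^ c) / Real.log M ^ c)) *
              ∑ j ∈ Icc 1 (⌊M⌋₊ / n), if j.Prime ∧ ¬ j ∣ n then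
                Real.log j / ((j : ℝ) + 1) *
                  ∑ c ∈ Finset.range (P.natDegree + 1), P.coeff c *
                    ((∑ k ∈ Icc 1 ⌊M / ((n * j : ℕ) : ℝ)⌋₊,
                      copTauW (n * j) k * Real.log (M / ((n * j : ℕ) : ℝ) / k) ^ c) / Real.log M ^ c)
                else 0) -
            2 * (mainConst n * ((derivative (derivative P)).eval (Real.log (M / n) / Real.log M) / Real.log M ^ 2)) *
              (mainConst n * (derivative P).eval (Real.log (M / n) / Real.log M) / Real.log M))| ≤
        C / Real.log M ^ 3 := by
  obtain ⟨C₁, hC₁, h1⟩ := abs_profileCoord_sub_derivative2_le P hP0 hP1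
  obtain ⟨C₃, hC₃, h3⟩ := abs_profileMain_le P
  obtain ⟨C_E, hC_E, hE⟩ := mainConst_le_divWeight
  obtain ⟨C_P, hC_P, hPC⟩ := abs_primeCoupling_sub_le P hP0 hP1
  set Q := derivative (derivative P) with hQ
  set Q₁ := derivative P with hQ₁
  set CQ₁ : ℝ := ∑ i ∈ Finset.range (Q₁.natDegree + 1), |Q₁.coeff i| with hCQ₁
  have hCQ₁0 : 0 ≤ CQ₁ := Finset.sum_nonneg fun i _ ↦ abs_nonneg _
  set Z : ℝ := (∑' d : ℕ, (d : ℝ) ^ (-(5 / 4 : ℝ))) ^ 2 with hZ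
  have hZ0 : 0 ≤ Z := sq_nonneg _
  set A : ℝ := C₁ * (CQ₁ * C_E) with hA
  set B : ℝ := 2 * C₁ * C_P + C₃ * C_E * C_P with hB
  have hA0 : 0 ≤ A := by positivity
  have hB0 : 0 ≤ B := by positivity
  refine ⟨2 * A * (8 * Z) + 2 * A * (3 * Z) + 2 * B * (3 * Z) + 2 * B * (144 * Z) + 1, by positivity,
    fun M hM ↦ ?_⟩
  -- abbreviations for the coordinate and the coupling
  obtain ⟨S, hS⟩ : ∃ S : ℕ → ℝ, ∀ n, S n = ∑ c ∈ Finset.range (P.natDegree + 1), P.coeff c *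
    ((∑ k ∈ Icc 1 ⌊M / n⌋₊, copTauW n k * Real.log (M / n / k) ^ c) / Real.log M ^ c) := ⟨_, fun _ ↦ rfl⟩
  simp only [← hS]
  obtain ⟨Pc, hPc⟩ : ∃ Pc : ℕ → ℝ, ∀ n, Pc n = ∑ j ∈ Icc 1 (⌊M⌋₊ / n),
      (if j.Prime ∧ ¬ j ∣ n then Real.log j / ((j : ℝ) + 1) * S (n * j) else 0) := ⟨_, fun _ ↦ rfl⟩
  simp only [← hPc]
  set ℓ := Real.log M with hℓ
  have hℓ1 : 1 ≤ ℓ := one_le_log_of_three_le hM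
  have hℓ0 : 0 < ℓ := by linarith
  have hM0 : 0 < M := by linarith
  have hM1 : (1 : ℝ) ≤ M := by linarith
  set N := ⌊M⌋₊ with hN
  have hN1 : 1 ≤ N := Nat.le_floor (by simpa using hM1)
  have hNM : (N : ℝ) ≤ M := Nat.floor_le hM0.le
  have hlogN : Real.log N ≤ ℓ := Real.log_le_log (by exact_mod_cast hN1) hNM
  have hlogN0 : 0 ≤ Real.log N := Real.log_nonneg (by exact_mod_cast hN1)
  -- pointwise bound
  have hterm : ∀ n ∈ Icc 1 N, |(Nat.totient n : ℝ) * W n ^ 2 *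
      (2 * (S n * Pc n) - 2 * (mainConst n * (Q.eval (Real.log (M / n) / ℓ) / ℓ ^ 2)) *
        (mainConst n * Q₁.eval (Real.log (M / n) / ℓ) / ℓ))| ≤
      2 * A / ℓ ^ 3 * (divWeight n ^ 2 / (n * (1 + Real.log (M / n)) ^ 2)) +
        2 * A / ℓ ^ 4 * (divWeight n ^ 2 / n) + 2 * B / ℓ ^ 4 * (divWeight n ^ 2 / n) +
        2 * B / ℓ ^ 4 * (kappa n * divWeight n ^ 2 / n) := by
    intro n hn
    have hn' := Finset.mem_Icc.1 hn
    have hn0 : n ≠ 0 := by omega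
    have hn0' : (0 : ℝ) < n := by exact_mod_cast hn'.1
    have hnM : (n : ℝ) ≤ M := le_trans (by exact_mod_cast hn'.2) hNM
    set s := S n with hs
    set pc := Pc n with hpc
    set m := mainConst n * (Q.eval (Real.log (M / n) / ℓ) / ℓ ^ 2) with hm
    set p := mainConst n * Q₁.eval (Real.log (M / n) / ℓ) / ℓ with hp
    set y := Real.log (M / n) with hy
    obtain ⟨hy0, hyℓ⟩ := log_div_nonneg_and_le hM hn0 hnM
    rw [← hy] at hy0 hyℓ
    have hu0 : 0 ≤ y / ℓ := div_nonneg hy0 hℓ0.le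
    have hu1 : y / ℓ ≤ 1 := (div_le_one hℓ0).2 hyℓ
    have hD := divWeight_nonneg n
    have hE0 := mainConst_nonneg n
    have hEn := hE n hn0
    have hκ : 0 ≤ kappa n := by
      unfold kappa
      exact Finset.sum_nonneg fun q hq ↦ by
        have hq2 : (2 : ℝ) ≤ q := by exact_mod_cast (Nat.prime_of_mem_primeFactors hq).two_le
        exact div_nonneg (Real.log_nonneg (by linarith)) (by linarith)
    -- the four sizes
    have hδ : |s - m| ≤ C₁ * divWeight n * (1 / ((1 + y) ^ 2 * ℓ ^ 2) + 1 / ℓ ^ 3) := by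
      have := h1 M hM n hn0 hnM
      rwa [← hS n] at this
    have hε : |pc - p| ≤ C_P * divWeight n * (1 + kappa n) / ℓ ^ 2 := by
      have h := hPC M hM n hn0 hnM
      rw [sum_coeff_derivative2_mul_pow_succ_eq P hP1] at h
      simp only [← hℓ, ← hN] at h
      simp only [← hS] at h
      rwa [← hPc n] at h
    have hmb : |m| ≤ C₃ * C_E * divWeight n / ℓ ^ 2 := by
      have h := h3 M hM n hn0 hnM
      rw [sum_coeff_mul_desc_eq_derivative2_eval P hℓ0.ne'] at h
      calc |m| ≤ C₃ * mainConst n / ℓ ^ 2 := h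
        _ ≤ C₃ * (C_E * divWeight n) / ℓ ^ 2 := by gcongr
        _ = C₃ * C_E * divWeight n / ℓ ^ 2 := by ring
    have hpb : |p| ≤ CQ₁ * C_E * divWeight n / ℓ := by
      have hq : |Q₁.eval (y / ℓ)| ≤ CQ₁ := by
        -- `|Q₁(u)| ≤ Σ_i |Q₁,i|` on `[0,1]` (as `Literature…ConreyMollifier.abs_eval_le_sum_abs_coeff`)
        rw [hCQ₁, Polynomial.eval_eq_sum_range]
        refine (Finset.abs_sum_le_sum_abs _ _).trans (Finset.sum_le_sum fun c _ ↦ ?_)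
        rw [abs_mul, abs_pow, abs_of_nonneg hu0]
        exact mul_le_of_le_one_right (abs_nonneg _) (pow_le_one₀ hu0 hu1)
      rw [hp, abs_div, abs_mul, abs_of_nonneg hE0, abs_of_pos hℓ0]
      calc mainConst n * |Q₁.eval (y / ℓ)| / ℓ ≤ (C_E * divWeight n) * CQ₁ / ℓ := by gcongr
        _ = CQ₁ * C_E * divWeight n / ℓ := by ring
    have hpcb : |pc| ≤ CQ₁ * C_E * divWeight n / ℓ + C_P * divWeight n * (1 + kappa n) / ℓ ^ 2 := by
      calc |pc| = |p + (pc - p)| := by ring_nf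
        _ ≤ |p| + |pc - p| := abs_add_le _ _
        _ ≤ _ := add_le_add hpb hε
    -- the product estimate
    have hscale : 1 / ((1 + y) ^ 2 * ℓ ^ 2) + 1 / ℓ ^ 3 ≤ 2 / ℓ ^ 2 :=
      inv_scale_sum_le (one_le_pow₀ (by linarith : (1 : ℝ) ≤ 1 + y)) hℓ1
    have hc := totient_mul_W_sq_le n
    have hc0 : 0 ≤ (Nat.totient n : ℝ) * W n ^ 2 := by positivity
    have hin : |s * pc - m * p| ≤
        C₁ * divWeight n * (1 / ((1 + y) ^ 2 * ℓ ^ 2) + 1 / ℓ ^ 3) * (CQ₁ * C_E * divWeight n / ℓ) +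
          C₁ * divWeight n * (2 / ℓ ^ 2) * (C_P * divWeight n * (1 + kappa n) / ℓ ^ 2) +
          (C₃ * C_E * divWeight n / ℓ ^ 2) * (C_P * divWeight n * (1 + kappa n) / ℓ ^ 2) := by
      have e : s * pc - m * p = (s - m) * pc + m * (pc - p) := by ring
      rw [e]
      calc |(s - m) * pc + m * (pc - p)| ≤ |(s - m) * pc| + |m * (pc - p)| := abs_add_le _ _
        _ = |s - m| * |pc| + |m| * |pc - p| := by rw [abs_mul, abs_mul]
        _ ≤ C₁ * divWeight n * (1 / ((1 + y) ^ 2 * ℓ ^ 2) + 1 / ℓ ^ 3) *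
              (CQ₁ * C_E * divWeight n / ℓ + C_P * divWeight n * (1 + kappa n) / ℓ ^ 2) +
            (C₃ * C_E * divWeight n / ℓ ^ 2) * (C_P * divWeight n * (1 + kappa n) / ℓ ^ 2) := by
            gcongr
        _ = C₁ * divWeight n * (1 / ((1 + y) ^ 2 * ℓ ^ 2) + 1 / ℓ ^ 3) * (CQ₁ * C_E * divWeight n / ℓ) +
              C₁ * divWeight n * (1 / ((1 + y) ^ 2 * ℓ ^ 2) + 1 / ℓ ^ 3) *
                (C_P * divWeight n * (1 + kappa n) / ℓ ^ 2) +
              (C₃ * C_E * divWeight n / ℓ ^ 2) * (C_P * divWeight n * (1 + kappa n) / ℓ ^ 2) := by ring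
        _ ≤ _ := by gcongr
    have hin' : |s * pc - m * p| ≤
        A * (divWeight n ^ 2 / (1 + y) ^ 2 / ℓ ^ 3 + divWeight n ^ 2 / ℓ ^ 4) +
          B * (divWeight n ^ 2 * (1 + kappa n) / ℓ ^ 4) := by
      refine hin.trans (le_of_eq ?_)
      rw [hA, hB]
      field_simp
      ring
    have h2 : |2 * (s * pc) - 2 * m * p| = 2 * |s * pc - m * p| := by
      rw [show 2 * (s * pc) - 2 * m * p = 2 * (s * pc - m * p) by ring, abs_mul, abs_two]
    rw [abs_mul, abs_of_nonneg hc0, h2]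
    calc (Nat.totient n : ℝ) * W n ^ 2 * (2 * |s * pc - m * p|)
        ≤ (n : ℝ)⁻¹ * (2 * (A * (divWeight n ^ 2 / (1 + y) ^ 2 / ℓ ^ 3 + divWeight n ^ 2 / ℓ ^ 4) +
            B * (divWeight n ^ 2 * (1 + kappa n) / ℓ ^ 4))) :=
          mul_le_mul hc (by linarith) (by positivity) (by positivity)
      _ = 2 * A / ℓ ^ 3 * (divWeight n ^ 2 / (n * (1 + y) ^ 2)) +
            2 * A / ℓ ^ 4 * (divWeight n ^ 2 / n) + 2 * B / ℓ ^ 4 * (divWeight n ^ 2 / n) +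
            2 * B / ℓ ^ 4 * (kappa n * divWeight n ^ 2 / n) := by
          field_simp
          ring
  -- sum the pointwise bound
  have hS1 := sum_divWeight_sq_dyadic_le hM1
  have hS2 := sum_divWeight_sq_div_le hN1
  have hS3 := sum_kappa_divWeight_sq_div_le hN1
  rw [← hZ, ← hN] at hS1
  rw [← hZ] at hS2 hS3
  have hS2' : ∑ n ∈ Icc 1 N, divWeight n ^ 2 / n ≤ Z * (3 * ℓ) :=
    hS2.trans (by gcongr; linarith)
  have hS3' : ∑ n ∈ Icc 1 N, kappa n * divWeight n ^ 2 / n ≤ 48 * Z * (3 * ℓ) :=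
    hS3.trans (by gcongr; linarith)
  refine (Finset.sum_le_sum hterm).trans ?_
  simp only [Finset.sum_add_distrib, ← Finset.mul_sum]
  have hT1 : 2 * A / ℓ ^ 3 * ∑ n ∈ Icc 1 N, divWeight n ^ 2 / (n * (1 + Real.log (M / n)) ^ 2) ≤
      2 * A * (8 * Z) / ℓ ^ 3 := by
    calc 2 * A / ℓ ^ 3 * ∑ n ∈ Icc 1 N, divWeight n ^ 2 / (n * (1 + Real.log (M / n)) ^ 2)
        ≤ 2 * A / ℓ ^ 3 * (8 * Z) := mul_le_mul_of_nonneg_left hS1 (by positivity)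
      _ = 2 * A * (8 * Z) / ℓ ^ 3 := by ring
  have hT2 : 2 * A / ℓ ^ 4 * ∑ n ∈ Icc 1 N, divWeight n ^ 2 / n ≤ 2 * A * (3 * Z) / ℓ ^ 3 := by
    calc 2 * A / ℓ ^ 4 * ∑ n ∈ Icc 1 N, divWeight n ^ 2 / n
        ≤ 2 * A / ℓ ^ 4 * (Z * (3 * ℓ)) := mul_le_mul_of_nonneg_left hS2' (by positivity)
      _ = 2 * A * (3 * Z) / ℓ ^ 3 := by field_simp
  have hT3 : 2 * B / ℓ ^ 4 * ∑ n ∈ Icc 1 N, divWeight n ^ 2 / n ≤ 2 * B * (3 * Z) / ℓ ^ 3 := by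
    calc 2 * B / ℓ ^ 4 * ∑ n ∈ Icc 1 N, divWeight n ^ 2 / n
        ≤ 2 * B / ℓ ^ 4 * (Z * (3 * ℓ)) := mul_le_mul_of_nonneg_left hS2' (by positivity)
      _ = 2 * B * (3 * Z) / ℓ ^ 3 := by field_simp
  have hT4 : 2 * B / ℓ ^ 4 * ∑ n ∈ Icc 1 N, kappa n * divWeight n ^ 2 / n ≤ 2 * B * (144 * Z) / ℓ ^ 3 := by
    calc 2 * B / ℓ ^ 4 * ∑ n ∈ Icc 1 N, kappa n * divWeight n ^ 2 / n
        ≤ 2 * B / ℓ ^ 4 * (48 * Z * (3 * ℓ)) := mul_le_mul_of_nonneg_left hS3' (by positivity)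
      _ = 2 * B * (144 * Z) / ℓ ^ 3 := by field_simp; ring
  calc 2 * A / ℓ ^ 3 * ∑ n ∈ Icc 1 N, divWeight n ^ 2 / (n * (1 + Real.log (M / n)) ^ 2) +
        2 * A / ℓ ^ 4 * ∑ n ∈ Icc 1 N, divWeight n ^ 2 / n + 2 * B / ℓ ^ 4 * ∑ n ∈ Icc 1 N, divWeight n ^ 2 / n +
        2 * B / ℓ ^ 4 * ∑ n ∈ Icc 1 N, kappa n * divWeight n ^ 2 / n
      ≤ 2 * A * (8 * Z) / ℓ ^ 3 + 2 * A * (3 * Z) / ℓ ^ 3 + 2 * B * (3 * Z) / ℓ ^ 3 +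
          2 * B * (144 * Z) / ℓ ^ 3 := add_le_add (add_le_add (add_le_add hT1 hT2) hT3) hT4
    _ = (2 * A * (8 * Z) + 2 * A * (3 * Z) + 2 * B * (3 * Z) + 2 * B * (144 * Z)) / ℓ ^ 3 := by ring
    _ ≤ (2 * A * (8 * Z) + 2 * A * (3 * Z) + 2 * B * (3 * Z) + 2 * B * (144 * Z) + 1) / ℓ ^ 3 :=
        div_le_div_of_nonneg_right (by linarith) (by positivity)


/-! ### The `𝒫`-term -/

/-- **The prime term of the general-profile kernel form.** For a real polynomial `P` with `P₀ = P₁ = 0` there is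
`C_P` such that for all `M ≥ 3`, with `𝒮_n = Σ_c P_c S⁽ᶜ⁾(M/n;n)/logᶜM` the profile coordinate and
`𝒫_n = Σ_{j ≤ ⌊M⌋/n, j prime, j∤n}(log j/(j+1))𝒮_{nj}` the prime coupling,
`|Σ_{n≤M} φ(n)W(n)²·2𝒮_n𝒫_n − ζ(2)²·P′(1)²/log²M| ≤ C_P/log³M`.
[cite: KowalskiMichelVanderKam2000, Prop. 5.1 — derivation (the term `(Q(1)P′(1))²` of (31) at `Q = 1`, general profile)] -/
theorem abs_PTerm_sub_le (P : ℝ[X]) (hP0 : P.coeff 0 = 0) (hP1 : P.coeff 1 = 0) :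
    ∃ C : ℝ, 0 < C ∧ ∀ M : ℝ, 3 ≤ M →
      |∑ n ∈ Icc 1 ⌊M⌋₊, (Nat.totient n : ℝ) * W n ^ 2 *
          (2 * ((∑ c ∈ Finset.range (P.natDegree + 1), P.coeff c *
                ((∑ k ∈ Icc 1 ⌊M / n⌋₊, copTauW n k * Real.log (M / n / k) ^ c) / Real.log M ^ c)) *
              ∑ j ∈ Icc 1 (⌊M⌋₊ / n), if j.Prime ∧ ¬ j ∣ n then
                Real.log j / ((j : ℝ) + 1) *
                  ∑ c ∈ Finset.range (P.natDegree + 1), P.coeff c *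
                    ((∑ k ∈ Icc 1 ⌊M / ((n * j : ℕ) : ℝ)⌋₊,
                      copTauW (n * j) k * Real.log (M / ((n * j : ℕ) : ℝ) / k) ^ c) / Real.log M ^ c)
                else 0)) -
        (π ^ 2 / 6) ^ 2 * (derivative P).eval 1 ^ 2 / Real.log M ^ 2| ≤ C / Real.log M ^ 3 := by
  obtain ⟨C₁, hC₁, h1⟩ := abs_PMain_sub_le P hP1
  obtain ⟨C₂, hC₂, h2⟩ := abs_PErr_le P hP0 hP1
  refine ⟨C₁ + C₂, by positivity, fun M hM ↦ ?_⟩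
  -- abbreviations
  obtain ⟨S, hS⟩ : ∃ S : ℕ → ℝ, ∀ n, S n = ∑ c ∈ Finset.range (P.natDegree + 1), P.coeff c *
    ((∑ k ∈ Icc 1 ⌊M / n⌋₊, copTauW n k * Real.log (M / n / k) ^ c) / Real.log M ^ c) := ⟨_, fun _ ↦ rfl⟩
  have hA := h1 M hM
  have hB := h2 M hM
  simp only [← hS] at hB ⊢
  obtain ⟨Pc, hPc⟩ : ∃ Pc : ℕ → ℝ, ∀ n, Pc n = ∑ j ∈ Icc 1 (⌊M⌋₊ / n),
      (if j.Prime ∧ ¬ j ∣ n then Real.log j / ((j : ℝ) + 1) * S (n * j) else 0) := ⟨_, fun _ ↦ rfl⟩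
  simp only [← hPc] at hB ⊢
  set ℓ := Real.log M with hℓ
  set Q := derivative (derivative P) with hQ
  set Q₁ := derivative P with hQ₁
  set N := ⌊M⌋₊ with hN
  -- the pointwise split `2𝒮𝒫 = 2mp + (2𝒮𝒫 − 2mp)`
  have hsplit : ∀ n ∈ Icc 1 N, (Nat.totient n : ℝ) * W n ^ 2 * (2 * (S n * Pc n)) =
      (Nat.totient n : ℝ) * W n ^ 2 *
          (2 * (mainConst n * (Q.eval (Real.log (M / n) / ℓ) / ℓ ^ 2)) *
            (mainConst n * Q₁.eval (Real.log (M / n) / ℓ) / ℓ)) +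
        (Nat.totient n : ℝ) * W n ^ 2 *
          (2 * (S n * Pc n) - 2 * (mainConst n * (Q.eval (Real.log (M / n) / ℓ) / ℓ ^ 2)) *
            (mainConst n * Q₁.eval (Real.log (M / n) / ℓ) / ℓ)) := by
    intro n _
    ring
  rw [Finset.sum_congr rfl hsplit, Finset.sum_add_distrib]
  calc _ ≤ |∑ n ∈ Icc 1 N, (Nat.totient n : ℝ) * W n ^ 2 *
            (2 * (mainConst n * (Q.eval (Real.log (M / n) / ℓ) / ℓ ^ 2)) *
              (mainConst n * Q₁.eval (Real.log (M / n) / ℓ) / ℓ)) -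
          (π ^ 2 / 6) ^ 2 * Q₁.eval 1 ^ 2 / ℓ ^ 2| +
        |∑ n ∈ Icc 1 N, (Nat.totient n : ℝ) * W n ^ 2 *
          (2 * (S n * Pc n) - 2 * (mainConst n * (Q.eval (Real.log (M / n) / ℓ) / ℓ ^ 2)) *
            (mainConst n * Q₁.eval (Real.log (M / n) / ℓ) / ℓ))| := by
        rw [show ∀ a b c : ℝ, a + b - c = (a - c) + b from fun a b c ↦ by ring]
        exact abs_add_le _ _
    _ ≤ C₁ / ℓ ^ 3 + C₂ / ℓ ^ 3 := add_le_add hA ((Finset.abs_sum_le_sum_abs _ _).trans hB)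
    _ = (C₁ + C₂) / ℓ ^ 3 := by ring

end Summit.Parity.GeneralizedHardyLittlewood.Theorems.MomentsBeyondDiagonal.DiagKernel

end
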